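import Mathlib
import HarnessLib

/-!
# Cycle heat kernel — walk expansion, positivity and the Chernoff tail (helper for stub `stub_treeRatioFloor`)

Positivity of the cycle heat kernel `q(s,m) = (1/L)∑_k e^{-sε(k)} cos(2πkm/L)` is invisible on the Fourier side;
it follows from the walk expansion: `e^{-sε(k)} = e^{-2s} ∑_t (s^t/t!) (2cos θ_k)^t` and
`∑_k (2cos θ_k)^t cos(θ_k m) = ∑_r C(t,r) ∑_k cos(θ_k (2r - t + m)) ≥ 0`, because a character sum
`∑_{k ∈ ZMod L} cos(2πkM/L)` equals `L` if `L ∣ M` and `0` otherwise.  The same expansion gives the Chernoff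
tail bound `∑_{|m| ≥ h} q(s,m) ≤ 2 e^{-θh} e^{(2cosh θ - 2)s}` (`θ ≥ 0`): the residue `-(2r-t)` is at cyclic
distance `≤ |2r - t|` from `0`, and `∑_r C(t,r) e^{±θ(2r-t)} = (2cosh θ)^t`.
Theorems only (hypotheses `hε hq` as in `…CycleKernelBasics`); registered helper stub `CycleKernelNonneg`.
-/

noncomputable section

namespace Summit.QuantumFields.YangMills.Theorems.FemtoCurvatureSkewness

open Finset
open scoped BigOperators

namespace CycleKernel

variable {L : ℕ} [NeZero L]

/-! ## Character sums on `ZMod L` -/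

/-- `∑_{k ∈ ZMod L} exp(2πi k M/L) = L` if `L ∣ M`, and `= 0` otherwise (geometric sum of roots of unity). -/
theorem sum_exp_char (M : ℤ) :
    ∑ k : ZMod L, Complex.exp (((2 * Real.pi * (k.val : ℝ) * M / L : ℝ) : ℂ) * Complex.I) =
      if ((M : ZMod L) = 0) then (L : ℂ) else 0 := by
  have hL : (L : ℝ) ≠ 0 := Nat.cast_ne_zero.mpr (NeZero.ne L)
  have hLc : (L : ℂ) ≠ 0 := Nat.cast_ne_zero.mpr (NeZero.ne L)
  set ω : ℂ := Complex.exp (((2 * Real.pi * M / L : ℝ) : ℂ) * Complex.I) with hω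
  have hterm : ∀ k : ZMod L,
      Complex.exp (((2 * Real.pi * (k.val : ℝ) * M / L : ℝ) : ℂ) * Complex.I) = ω ^ k.val := by
    intro k
    rw [hω, ← Complex.exp_nat_mul]
    congr 1
    push_cast
    ring
  simp_rw [hterm]
  rw [show ∑ k : ZMod L, ω ^ k.val = ∑ j ∈ Finset.range L, ω ^ j from
    Finset.sum_nbij' (fun k => k.val) (fun j => (j : ZMod L)) (fun k _ => Finset.mem_range.mpr (ZMod.val_lt k))
      (fun j _ => Finset.mem_univ _) (fun k _ => ZMod.natCast_zmod_val k)
      (fun j hj => ZMod.val_cast_of_lt (Finset.mem_range.mp hj)) (fun k _ => rfl)]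
  have hωL : ω ^ L = 1 := by
    rw [hω, ← Complex.exp_nat_mul]
    have h : (L : ℂ) * ((((2 * Real.pi * M / L : ℝ)) : ℂ) * Complex.I) = (M : ℂ) * (2 * Real.pi * Complex.I) := by
      push_cast
      field_simp
    rw [h]
    exact Complex.exp_int_mul_two_pi_mul_I M
  have hω1 : ω = 1 → ((M : ZMod L) = 0) := by
    rw [ZMod.intCast_zmod_eq_zero_iff_dvd, hω, Complex.exp_eq_one_iff]
    rintro ⟨n, hn⟩
    have h2 : (((2 * Real.pi * M / L : ℝ)) : ℂ) * Complex.I = (((n * (2 * Real.pi) : ℝ)) : ℂ) * Complex.I := by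
      rw [hn]; push_cast; ring
    have h3 := Complex.ofReal_inj.mp (mul_right_cancel₀ Complex.I_ne_zero h2)
    have h4 : (M : ℝ) = n * L := by
      field_simp at h3
      nlinarith [Real.pi_pos]
    exact ⟨n, by exact_mod_cast (show (M : ℝ) = L * n by rw [h4]; ring)⟩
  by_cases h1 : (M : ZMod L) = 0
  · rw [if_pos h1]
    obtain ⟨c, hc⟩ := (ZMod.intCast_zmod_eq_zero_iff_dvd M L).mp h1
    have hω' : ω = 1 := by
      rw [hω, Complex.exp_eq_one_iff]
      exact ⟨c, by rw [hc]; push_cast; field_simp⟩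
    simp [hω']
  · rw [if_neg h1, geom_sum_eq (fun h => h1 (hω1 h)), hωL]
    simp

/-- `∑_{k ∈ ZMod L} cos(2π k M/L) = L` if `L ∣ M`, else `0`. -/
theorem sum_cos_char (M : ℤ) :
    ∑ k : ZMod L, Real.cos (2 * Real.pi * (k.val : ℝ) * M / L) = if ((M : ZMod L) = 0) then (L : ℝ) else 0 := by
  have h := congrArg Complex.re (sum_exp_char (L := L) M)
  rw [Complex.re_sum] at h
  simp only [Complex.exp_ofReal_mul_I_re] at h
  rw [h]
  split_ifs <;> simp

/-- `∑_{k ∈ ZMod L} sin(2π k M/L) = 0`. -/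
theorem sum_sin_char (M : ℤ) : ∑ k : ZMod L, Real.sin (2 * Real.pi * (k.val : ℝ) * M / L) = 0 := by
  have h := congrArg Complex.im (sum_exp_char (L := L) M)
  rw [Complex.im_sum] at h
  simp only [Complex.exp_ofReal_mul_I_im] at h
  rw [h]
  split_ifs <;> simp

/-- Character sums are non-negative. -/
theorem sum_cos_char_nonneg (M : ℤ) : 0 ≤ ∑ k : ZMod L, Real.cos (2 * Real.pi * (k.val : ℝ) * M / L) := by
  rw [sum_cos_char]
  split_ifs <;> positivity

/-! ## The expansion `(2cos θ)^t cos(xθ) = ∑_r C(t,r) cos((2r - t + x)θ)` -/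

/-- Pascal re-indexing: `∑_{r ≤ t+1} C(t+1,r) c_r = ∑_{r ≤ t} C(t,r) c_{r+1} + ∑_{r ≤ t} C(t,r) c_r`. -/
theorem sum_choose_succ_mul (t : ℕ) (c : ℕ → ℝ) :
    ∑ r ∈ range (t + 1 + 1), ((t + 1).choose r : ℝ) * c r =
      ∑ r ∈ range (t + 1), (t.choose r : ℝ) * c (r + 1) + ∑ r ∈ range (t + 1), (t.choose r : ℝ) * c r := by
  have h1 : ∑ r ∈ range (t + 1), ((t + 1).choose (r + 1) : ℝ) * c (r + 1) =
      ∑ r ∈ range (t + 1), (t.choose r : ℝ) * c (r + 1) +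
        ∑ r ∈ range (t + 1), (t.choose (r + 1) : ℝ) * c (r + 1) := by
    rw [← Finset.sum_add_distrib]
    refine Finset.sum_congr rfl fun r _ => ?_
    rw [Nat.choose_succ_succ']
    push_cast
    ring
  have h2 : ∑ r ∈ range (t + 1), (t.choose (r + 1) : ℝ) * c (r + 1) =
      ∑ r ∈ range t, (t.choose (r + 1) : ℝ) * c (r + 1) := by
    rw [Finset.sum_range_succ, Nat.choose_succ_self]
    simp
  have h3 : ∑ r ∈ range (t + 1), (t.choose r : ℝ) * c r =
      ∑ r ∈ range t, (t.choose (r + 1) : ℝ) * c (r + 1) + (t.choose 0 : ℝ) * c 0 :=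
    Finset.sum_range_succ' _ _
  rw [Finset.sum_range_succ' _ (t + 1), h1, h2, h3]
  simp
  ring

/-- **Chebyshev-type expansion**: `(2cos θ)^t cos(xθ) = ∑_{r=0}^{t} C(t,r) cos((2r - t + x)θ)`
(induction on `t` via `2cos θ cos(xθ) = cos((x+1)θ) + cos((x-1)θ)`). -/
theorem two_cos_pow_mul_cos (θ : ℝ) (t : ℕ) : ∀ x : ℝ,
    (2 * Real.cos θ) ^ t * Real.cos (x * θ) =
      ∑ r ∈ range (t + 1), (t.choose r : ℝ) * Real.cos ((2 * (r : ℝ) - t + x) * θ) := by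
  induction t with
  | zero => intro x; simp
  | succ t ih =>
    intro x
    have e2 : 2 * Real.cos θ * Real.cos (x * θ) = Real.cos ((x + 1) * θ) + Real.cos ((x - 1) * θ) := by
      rw [add_mul, sub_mul, one_mul, Real.cos_add, Real.cos_sub]
      ring
    calc (2 * Real.cos θ) ^ (t + 1) * Real.cos (x * θ)
        = (2 * Real.cos θ) ^ t * (2 * Real.cos θ * Real.cos (x * θ)) := by ring
      _ = (2 * Real.cos θ) ^ t * Real.cos ((x + 1) * θ) + (2 * Real.cos θ) ^ t * Real.cos ((x - 1) * θ) := by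
          rw [e2]; ring
      _ = ∑ r ∈ range (t + 1), (t.choose r : ℝ) * Real.cos ((2 * (r : ℝ) - t + (x + 1)) * θ) +
          ∑ r ∈ range (t + 1), (t.choose r : ℝ) * Real.cos ((2 * (r : ℝ) - t + (x - 1)) * θ) := by
          rw [ih, ih]
      _ = ∑ r ∈ range (t + 1 + 1), ((t + 1).choose r : ℝ) *
            Real.cos ((2 * (r : ℝ) - (t + 1 : ℕ) + x) * θ) := by
          rw [sum_choose_succ_mul t (fun r => Real.cos ((2 * (r : ℝ) - (t + 1 : ℕ) + x) * θ))]
          congr 1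
          · refine Finset.sum_congr rfl fun r _ => ?_
            congr 2
            push_cast
            ring
          · refine Finset.sum_congr rfl fun r _ => ?_
            congr 2
            push_cast
            ring

/-! ## Walk numbers: `P_t(m) = ∑_k (2cos θ_k)^t cos(θ_k m) ≥ 0` -/

/-- `P_t(m) = ∑_r C(t,r) ∑_k cos(2πk(2r - t + m)/L)`. -/
theorem walk_sum_eq (t : ℕ) (m : ZMod L) :
    ∑ k : ZMod L, (2 * Real.cos (2 * Real.pi * (k.val : ℝ) / L)) ^ t *
        Real.cos (2 * Real.pi * (k.val : ℝ) * (m.val : ℝ) / L) =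
      ∑ r ∈ range (t + 1), (t.choose r : ℝ) *
        ∑ k : ZMod L, Real.cos (2 * Real.pi * (k.val : ℝ) * ((2 * r - t + m.val : ℤ) : ℝ) / L) := by
  have hL : (L : ℝ) ≠ 0 := Nat.cast_ne_zero.mpr (NeZero.ne L)
  calc ∑ k : ZMod L, (2 * Real.cos (2 * Real.pi * (k.val : ℝ) / L)) ^ t *
        Real.cos (2 * Real.pi * (k.val : ℝ) * (m.val : ℝ) / L)
      = ∑ k : ZMod L, ∑ r ∈ range (t + 1), (t.choose r : ℝ) *
          Real.cos ((2 * (r : ℝ) - t + (m.val : ℝ)) * (2 * Real.pi * (k.val : ℝ) / L)) := by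
        refine Finset.sum_congr rfl fun k _ => ?_
        rw [← two_cos_pow_mul_cos]
        congr 2
        ring
    _ = ∑ r ∈ range (t + 1), ∑ k : ZMod L, (t.choose r : ℝ) *
          Real.cos ((2 * (r : ℝ) - t + (m.val : ℝ)) * (2 * Real.pi * (k.val : ℝ) / L)) := Finset.sum_comm
    _ = _ := by
        refine Finset.sum_congr rfl fun r _ => ?_
        rw [Finset.mul_sum]
        refine Finset.sum_congr rfl fun k _ => ?_
        congr 2
        push_cast
        ring

/-- `P_t(m) ≥ 0`. -/
theorem walk_sum_nonneg (t : ℕ) (m : ZMod L) :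
    0 ≤ ∑ k : ZMod L, (2 * Real.cos (2 * Real.pi * (k.val : ℝ) / L)) ^ t *
        Real.cos (2 * Real.pi * (k.val : ℝ) * (m.val : ℝ) / L) := by
  rw [walk_sum_eq]
  exact Finset.sum_nonneg fun r _ => mul_nonneg (Nat.cast_nonneg _) (sum_cos_char_nonneg _)

/-! ## Poisson representation and positivity of the kernel -/

section Kernel

variable {ε : ZMod L → ℝ} {q : ℝ → ZMod L → ℝ}

/-- **Walk (Poisson) expansion of the kernel**:
`q(s,m) = ∑_{t ≥ 0} (e^{-2s}/L) (s^t/t!) P_t(m)`. -/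
theorem hasSum_q (hε : ∀ k, ε k = 2 - 2 * Real.cos (2 * Real.pi * (k.val : ℝ) / L))
    (hq : ∀ s m, q s m = (∑ k : ZMod L, Real.exp (-(s * ε k)) *
      Real.cos (2 * Real.pi * (k.val : ℝ) * (m.val : ℝ) / L)) / L) (s : ℝ) (m : ZMod L) :
    HasSum (fun t : ℕ => Real.exp (-(2 * s)) / L * (s ^ t / t.factorial) *
      ∑ k : ZMod L, (2 * Real.cos (2 * Real.pi * (k.val : ℝ) / L)) ^ t *
        Real.cos (2 * Real.pi * (k.val : ℝ) * (m.val : ℝ) / L)) (q s m) := by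
  -- per mode: `e^{-sε(k)} cos(θ_k m) = ∑_t e^{-2s} (s 2cos θ_k)^t/t! cos(θ_k m)`
  have hk : ∀ k : ZMod L, HasSum (fun t : ℕ => Real.exp (-(2 * s)) * ((s * (2 * Real.cos (2 * Real.pi *
      (k.val : ℝ) / L))) ^ t / t.factorial) * Real.cos (2 * Real.pi * (k.val : ℝ) * (m.val : ℝ) / L))
      (Real.exp (-(s * ε k)) * Real.cos (2 * Real.pi * (k.val : ℝ) * (m.val : ℝ) / L)) := by
    intro k
    have h1 : HasSum (fun t : ℕ => (s * (2 * Real.cos (2 * Real.pi * (k.val : ℝ) / L))) ^ t / t.factorial)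
        (Real.exp (s * (2 * Real.cos (2 * Real.pi * (k.val : ℝ) / L)))) := by
      rw [Real.exp_eq_exp_ℝ]
      exact NormedSpace.expSeries_div_hasSum_exp _
    have h2 := (h1.mul_left (Real.exp (-(2 * s)))).mul_right
      (Real.cos (2 * Real.pi * (k.val : ℝ) * (m.val : ℝ) / L))
    have e : Real.exp (-(2 * s)) * Real.exp (s * (2 * Real.cos (2 * Real.pi * (k.val : ℝ) / L))) =
        Real.exp (-(s * ε k)) := by
      rw [← Real.exp_add, hε]
      ring_nf
    rwa [e] at h2
  have hsum := hasSum_sum (s := (Finset.univ : Finset (ZMod L))) fun k _ => hk k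
  have hdiv := hsum.div_const (L : ℝ)
  rw [← hq s m] at hdiv
  refine hdiv.congr_fun fun t => ?_
  rw [Finset.mul_sum, Finset.sum_div]
  refine Finset.sum_congr rfl fun k _ => ?_
  rw [mul_pow]
  ring

/-- **Positivity of the cycle heat kernel**: `0 ≤ q(s,m)` for `s ≥ 0`. -/
theorem q_nonneg (hε : ∀ k, ε k = 2 - 2 * Real.cos (2 * Real.pi * (k.val : ℝ) / L))
    (hq : ∀ s m, q s m = (∑ k : ZMod L, Real.exp (-(s * ε k)) *
      Real.cos (2 * Real.pi * (k.val : ℝ) * (m.val : ℝ) / L)) / L) {s : ℝ} (hs : 0 ≤ s) (m : ZMod L) :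
    0 ≤ q s m :=
  (hasSum_q hε hq s m).nonneg fun t => mul_nonneg (by positivity) (walk_sum_nonneg t m)

end Kernel

/-! ## The Chernoff tail bound -/

/-- Binomial identity `∑_r C(t,r) e^{φ(2r-t)} = (e^φ + e^{-φ})^t`. -/
theorem sum_choose_mul_exp (t : ℕ) (φ : ℝ) :
    ∑ r ∈ range (t + 1), (t.choose r : ℝ) * Real.exp (φ * (2 * r - t)) =
      (Real.exp φ + Real.exp (-φ)) ^ t := by
  rw [add_pow]
  refine Finset.sum_congr rfl fun r hr => ?_
  have hrt : r ≤ t := Nat.lt_succ_iff.mp (Finset.mem_range.mp hr)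
  rw [← Real.exp_nat_mul, ← Real.exp_nat_mul, ← Real.exp_add, Nat.cast_sub hrt]
  rw [mul_comm]
  congr 2
  ring

/-- `e^{θ(|x| - h)} ≤ e^{-θh} (e^{θx} + e^{-θx})`. -/
theorem exp_abs_sub_le (θ x h : ℝ) :
    Real.exp (θ * (|x| - h)) ≤ Real.exp (-(θ * h)) * (Real.exp (θ * x) + Real.exp (-θ * x)) := by
  have e : Real.exp (θ * (|x| - h)) = Real.exp (-(θ * h)) * Real.exp (θ * |x|) := by
    rw [← Real.exp_add]; ring_nf
  rw [e]
  refine mul_le_mul_of_nonneg_left ?_ (Real.exp_nonneg _)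
  rcases le_total 0 x with hx | hx
  · rw [abs_of_nonneg hx]
    have := Real.exp_nonneg (-θ * x)
    linarith
  · rw [abs_of_nonpos hx]
    have := Real.exp_nonneg (θ * x)
    have e2 : Real.exp (θ * -x) = Real.exp (-θ * x) := by ring_nf
    linarith

/-- Tail of the walk numbers over the sites at cyclic distance `≥ h` from `0`:
`∑_{|m| ≥ h} P_t(m) ≤ 2L e^{-θh} (2cosh θ)^t` for `θ ≥ 0`. -/
theorem walk_tail_le (t h : ℕ) {θ : ℝ} (hθ : 0 ≤ θ) :
    ∑ m ∈ (Finset.univ : Finset (ZMod L)).filter (fun m => h ≤ m.valMinAbs.natAbs),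
      ∑ k : ZMod L, (2 * Real.cos (2 * Real.pi * (k.val : ℝ) / L)) ^ t *
        Real.cos (2 * Real.pi * (k.val : ℝ) * (m.val : ℝ) / L) ≤
      2 * L * Real.exp (-(θ * h)) * (2 * Real.cosh θ) ^ t := by
  have hL : (0 : ℝ) < L := by exact_mod_cast NeZero.pos L
  set S := (Finset.univ : Finset (ZMod L)).filter (fun m => h ≤ m.valMinAbs.natAbs) with hS
  -- the inner sum over the tail set, for a fixed integer shift `N`
  have inner : ∀ N : ℤ, ∑ m ∈ S, ∑ k : ZMod L, Real.cos (2 * Real.pi * (k.val : ℝ) * ((N + m.val : ℤ) : ℝ) / L) ≤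
      L * Real.exp (θ * (|(N : ℝ)| - h)) := by
    intro N
    have hrw : ∀ m : ZMod L, (∑ k : ZMod L, Real.cos (2 * Real.pi * (k.val : ℝ) * ((N + m.val : ℤ) : ℝ) / L)) =
        if m = -(N : ZMod L) then (L : ℝ) else 0 := by
      intro m
      rw [sum_cos_char]
      congr 1
      push_cast
      rw [ZMod.natCast_zmod_val, add_eq_zero_iff_eq_neg']
    simp_rw [hrw]
    rw [Finset.sum_ite_eq']
    split_ifs with hmem
    · -- the residue `-N` lies in the tail set, so `h ≤ |N|`
      have hle : h ≤ N.natAbs := by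
        have h1 : h ≤ (-(N : ZMod L)).valMinAbs.natAbs := (Finset.mem_filter.mp hmem).2
        have h2 : (-(N : ZMod L)).valMinAbs.natAbs ≤ (-N).natAbs :=
          ZMod.natAbs_min_of_le_div_two L _ _ (by rw [ZMod.coe_valMinAbs, Int.cast_neg])
            (ZMod.natAbs_valMinAbs_le _)
        rw [Int.natAbs_neg] at h2
        exact h1.trans h2
      have hle' : (h : ℝ) ≤ |(N : ℝ)| := by
        rw [← Int.cast_abs]
        exact_mod_cast (show (h : ℤ) ≤ |N| by rw [← Int.natCast_natAbs]; exact_mod_cast hle)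
      calc (L : ℝ) = L * 1 := (mul_one _).symm
        _ ≤ L * Real.exp (θ * (|(N : ℝ)| - h)) := by
            gcongr
            exact Real.one_le_exp (mul_nonneg hθ (by linarith))
    · positivity
  calc ∑ m ∈ S, ∑ k : ZMod L, (2 * Real.cos (2 * Real.pi * (k.val : ℝ) / L)) ^ t *
          Real.cos (2 * Real.pi * (k.val : ℝ) * (m.val : ℝ) / L)
      = ∑ m ∈ S, ∑ r ∈ range (t + 1), (t.choose r : ℝ) *
          ∑ k : ZMod L, Real.cos (2 * Real.pi * (k.val : ℝ) * ((2 * r - t + m.val : ℤ) : ℝ) / L) :=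
        Finset.sum_congr rfl fun m _ => walk_sum_eq t m
    _ = ∑ r ∈ range (t + 1), (t.choose r : ℝ) * ∑ m ∈ S,
          ∑ k : ZMod L, Real.cos (2 * Real.pi * (k.val : ℝ) * (((2 * r - t : ℤ) + m.val : ℤ) : ℝ) / L) := by
        rw [Finset.sum_comm]
        refine Finset.sum_congr rfl fun r _ => ?_
        rw [Finset.mul_sum]
    _ ≤ ∑ r ∈ range (t + 1), (t.choose r : ℝ) * (L * Real.exp (θ * (|((2 * r - t : ℤ) : ℝ)| - h))) := by
        gcongr with r hr
        exact inner _
    _ ≤ ∑ r ∈ range (t + 1), (t.choose r : ℝ) * (L * (Real.exp (-(θ * h)) *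
          (Real.exp (θ * (2 * r - t)) + Real.exp (-θ * (2 * r - t))))) := by
        gcongr with r hr
        push_cast
        exact exp_abs_sub_le θ _ _
    _ = L * Real.exp (-(θ * h)) * (∑ r ∈ range (t + 1), (t.choose r : ℝ) * Real.exp (θ * (2 * r - t)) +
          ∑ r ∈ range (t + 1), (t.choose r : ℝ) * Real.exp (-θ * (2 * r - t))) := by
        rw [← Finset.sum_add_distrib, Finset.mul_sum]
        refine Finset.sum_congr rfl fun r _ => ?_
        ring
    _ = 2 * L * Real.exp (-(θ * h)) * (2 * Real.cosh θ) ^ t := by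
        rw [sum_choose_mul_exp, sum_choose_mul_exp, neg_neg, Real.cosh_eq]
        ring

section Tail

variable {ε : ZMod L → ℝ} {q : ℝ → ZMod L → ℝ}

/-- **Chernoff tail bound for the cycle heat kernel**: for `s ≥ 0`, `θ ≥ 0` and `h ∈ ℕ`,
`∑_{|m| ≥ h} q(s,m) ≤ 2 e^{-θ h} e^{-2s + 2s cosh θ}`. -/
theorem tail_le (hε : ∀ k, ε k = 2 - 2 * Real.cos (2 * Real.pi * (k.val : ℝ) / L))
    (hq : ∀ s m, q s m = (∑ k : ZMod L, Real.exp (-(s * ε k)) *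
      Real.cos (2 * Real.pi * (k.val : ℝ) * (m.val : ℝ) / L)) / L) {s : ℝ} (hs : 0 ≤ s) (h : ℕ)
    {θ : ℝ} (hθ : 0 ≤ θ) :
    ∑ m ∈ (Finset.univ : Finset (ZMod L)).filter (fun m => h ≤ m.valMinAbs.natAbs), q s m ≤
      2 * Real.exp (-(θ * h)) * Real.exp (-(2 * s) + 2 * s * Real.cosh θ) := by
  have hL : (0 : ℝ) < L := by exact_mod_cast NeZero.pos L
  set S := (Finset.univ : Finset (ZMod L)).filter (fun m => h ≤ m.valMinAbs.natAbs) with hS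
  have h1 := hasSum_sum (s := S) fun m _ => hasSum_q hε hq s m
  have h2 : HasSum (fun t : ℕ => 2 * Real.exp (-(θ * h)) * Real.exp (-(2 * s)) *
      ((2 * s * Real.cosh θ) ^ t / t.factorial))
      (2 * Real.exp (-(θ * h)) * Real.exp (-(2 * s) + 2 * s * Real.cosh θ)) := by
    have h3 : HasSum (fun t : ℕ => (2 * s * Real.cosh θ) ^ t / t.factorial) (Real.exp (2 * s * Real.cosh θ)) := by
      rw [Real.exp_eq_exp_ℝ]
      exact NormedSpace.expSeries_div_hasSum_exp _
    have h4 := h3.mul_left (2 * Real.exp (-(θ * h)) * Real.exp (-(2 * s)))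
    rwa [Real.exp_add, show 2 * Real.exp (-(θ * h)) * (Real.exp (-(2 * s)) * Real.exp (2 * s * Real.cosh θ)) =
      2 * Real.exp (-(θ * h)) * Real.exp (-(2 * s)) * Real.exp (2 * s * Real.cosh θ) by ring]
  refine hasSum_le (fun t => ?_) h1 h2
  rw [← Finset.mul_sum]
  calc Real.exp (-(2 * s)) / L * (s ^ t / t.factorial) * ∑ m ∈ S, ∑ k : ZMod L,
        (2 * Real.cos (2 * Real.pi * (k.val : ℝ) / L)) ^ t * Real.cos (2 * Real.pi * (k.val : ℝ) * (m.val : ℝ) / L)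
      ≤ Real.exp (-(2 * s)) / L * (s ^ t / t.factorial) * (2 * L * Real.exp (-(θ * h)) * (2 * Real.cosh θ) ^ t) := by
        gcongr
        exact walk_tail_le t h hθ
    _ = 2 * Real.exp (-(θ * h)) * Real.exp (-(2 * s)) * ((2 * s * Real.cosh θ) ^ t / t.factorial) := by
        field_simp
        ring

end Tail

end CycleKernel

/-- **Positivity of the cycle heat kernel** (registered helper stub `CycleKernelNonneg` of stmt-QuantumFields-9365):
the Fourier sum `(1/L) ∑_k e^{-s(2-2cos(2πk/L))} cos(2πkm/L)` is non-negative for `s ≥ 0`. -/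
theorem CycleKernelNonneg : ∀ (L : ℕ) [NeZero L] (s : ℝ) (m : ZMod L), 0 ≤ s →
    0 ≤ (∑ k : ZMod L, Real.exp (-(s * (2 - 2 * Real.cos (2 * Real.pi * (k.val : ℝ) / L)))) *
      Real.cos (2 * Real.pi * (k.val : ℝ) * (m.val : ℝ) / L)) / L := by
  intro L _ s m hs
  exact CycleKernel.q_nonneg (L := L) (ε := fun k => 2 - 2 * Real.cos (2 * Real.pi * (k.val : ℝ) / L))
    (q := fun s m => (∑ k : ZMod L, Real.exp (-(s * (2 - 2 * Real.cos (2 * Real.pi * (k.val : ℝ) / L)))) *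
      Real.cos (2 * Real.pi * (k.val : ℝ) * (m.val : ℝ) / L)) / L) (fun _ => rfl) (fun _ _ => rfl) hs m

end Summit.QuantumFields.YangMills.Theorems.FemtoCurvatureSkewness

end
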